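import Literature.AlgebraicGeometry.ModuliOfAbelianVarieties.SiegelCMTorsionCongruence
import HarnessLib

/-!
# Sandwich transport: a lattice sandwich `⊕ᵢ 𝔞ᵢ ⊆ q⁻¹Λ_a ⊆ ⊕ᵢ 𝔟ᵢ` at a CM point pushed through the reciprocity element `r = R(t)`
# ([Deligne 1971] 4.18–4.20 (CM by an ORDER of `F`); [Shimura 1998] §18.3 `t𝔞`, §18.8 (proof); [Milne 2005] Def. 12.8 (60)–(63))

Topic `AlgebraicGeometry/ModuliOfAbelianVarieties`; namespaces `Literature.AlgebraicGeometry.ModuliOfAbelianVarieties` (§1, generic) and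
`….CMStructure` (§§2–5).  Cell hodgecm-mathlib (D-0151), #60 road (row I-7 `SiegelS1`): the LATTICE half of M3a-β in A-p06's CENSUS-M3a
(route ξ′, §4 row «dictionary», §5); the torsion half is ★ R60-43 `SiegelCMTorsionCongruence` (B-p01).  THEOREMS ONLY: no definition,
no named fact, no instance, no `sorry` (net Literature debt 0).  A banked GENERIC leaf (director s86 (2)(b)); HC_CM is proved only
modulo the printed citations until rung 0 closes.

## Why a sandwich (what ★ R60-35 / ★ R60-43 do not cover)

★ R60-35 `SiegelCMLatticeReciprocity` and ★ R60-43 work under the SPLIT reading `ha : Θ_v⁻¹(a·ẑ^{2g}) = ∏ᵢ 𝔞̂ᵢ` (an `iff`; `Θ_v(u) =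
R(u)·(v ⊗ 1)`, `R = cmRepMatrix`, `v` a cyclic vector): the lattice of `[J, a]` read in `F = ∏ᵢ Kᵢ` is a product of fractional ideals —
CM by the maximal order.  At a general CM point `q_v⁻¹(Λ_a)` is only SANDWICHED, `⊕ᵢ 𝔞ᵢ ⊆ q_v⁻¹(Λ_a) ⊆ ⊕ᵢ 𝔟ᵢ`
([Deligne1971TravauxShimura] 4.18: `V` free of rank one over `F` with an ARBITRARY lattice, i.e. CM by an order; the sandwich with
`𝔞ᵢ = N·𝔟ᵢ` is ★ R60-40a `exists_fractionalIdeal_sandwich`, [Shimura1998] §6.2 «commensurable» / §18.8 proof «`𝔞 = 𝔟₁ ⊕ ⋯ ⊕ 𝔟_t`»).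
This file redoes §§2–4 of R60-35 / R60-43 ONE-SIDED: the two inclusions of `ha` become two hypotheses at two ideal families,
`hlow : ∀ u, (∀ i, uᵢ ∈ 𝔞̂ᵢ) → a⁻¹·Θ_v(u) ∈ ẑ^{2g}` («`∏ᵢ 𝔞̂ᵢ ⊆ Θ_v⁻¹(a·ẑ^{2g})`») and
`hup : ∀ u, a⁻¹·Θ_v(u) ∈ ẑ^{2g} → ∀ i, uᵢ ∈ 𝔟̂ᵢ` («`Θ_v⁻¹(a·ẑ^{2g}) ⊆ ∏ᵢ 𝔟̂ᵢ`»), and every conclusion is an implication.  (The passage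
from the RATIONAL sandwich of ★ R60-40a to `hlow`/`hup` is the density/conductor argument of R60-35's «NOT here (i)» = R60-35b; not here.)
The (62) instance `c.cmRecipMatrix Φ E s` (the binder of ★ `SiegelRationalModel.IsCanonical`) IS `c.cmRepMatrix (N_{E,Φᵢ}(s))ᵢ` by
definition, so everything applies verbatim with `t := fun i => reflexNormFiniteIdele (K i) (Φ i) E s` (as ★ R60-35 §4 / ★ R60-43 §5).

## What is proved (`a r ∈ GL_{2g}(𝔸_{ℚ,f})`, `t ∈ ∏ᵢ 𝔸_{Kᵢ,f}^×`, `hr : (r : matrix) = R(t)`; `Λ_a = latticeOfGL a` ★ R60-19; `t𝔞 = ideleMulIdeal t 𝔞` ★)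

* §1 (generic, no CM; `a, b ∈ GL_n(𝔸_{ℚ,f})`, `v, w ∈ ℚⁿ`): along `a⁻¹·v̂ ≡ b⁻¹·ŵ (mod ẑⁿ)` ([Milne2005ShimuraVarieties] (63)) lattice
  membership transfers — `mem_latticeOfGL_iff_of_inv_mulVec_sub_mem` (`v ∈ Λ_a ↔ w ∈ Λ_b`), `sub_mem_latticeOfGL_of_inv_mulVec_sub_mem₂/₁`
  (two `w` for one `v` differ by `Λ_b`; two `v` for one `w` by `Λ_a`), `inv_mulVec_sub_mem_self_iff` (`b = a`: the congruence is
  `v − w ∈ Λ_a`) — the `hker` / well-definedness inputs of the division step ★ R60-44.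
* §2 `inv_mul_mulVec_cmRepMatrix_mul_mulVec` «`(r·a)⁻¹·Θ(t·u) = a⁻¹·Θ(u)`», `inv_mul_mulVec_cmRepMatrix_mulVec` «`(r·a)⁻¹·Θ(u) = a⁻¹·Θ(t⁻¹u)`».
* §3 ADELIC transport: `forall_inv_mul_mulVec_mem_of_forall_mem` (`hlow` ⇒ «`∏ᵢ (tᵢ𝔞ᵢ)^ ⊆ Θ_v⁻¹((r·a)·ẑ^{2g})`») and
  `forall_mem_of_forall_inv_mul_mulVec_mem` (`hup` ⇒ «`Θ_v⁻¹((r·a)·ẑ^{2g}) ⊆ ∏ᵢ (tᵢ𝔟ᵢ)^`»), by ★ `IdeleAction.mul_mem_idealAdeles_iff`.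
* §4 RATIONAL corollaries («`K ∩ 𝔞̂ = 𝔞`» ★ `algebraMap_mem_idealAdeles_iff`): **`act_mem_latticeOfGL_mul_of_forall_mem_ideleMulIdeal`**
  (`x ∈ ⊕ tᵢ𝔞ᵢ ⇒ act(x)·v ∈ Λ_{r·a}`, the integrality input of the torus map UP in route ξ′) and
  **`forall_mem_ideleMulIdeal_of_act_mem_latticeOfGL_mul`** (`act(x)·v ∈ Λ_{r·a} ⇒ x ∈ ⊕ tᵢ𝔟ᵢ`).
* §5 THE TORSION CLAUSE UP TO THE SANDWICH: `forall_inv_mulVec_sub_mem_of_forall_sub_mem` (adelic),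
  **`forall_inv_mulVec_act_sub_mem_of_forall_ideleMulEquiv`** (`hlow` at `𝔞` ⇒ (18.3a) `tᵢ·(xᵢ mod 𝔞ᵢ) = yᵢ mod tᵢ𝔞ᵢ` for all `i` ⇒
  `a⁻¹·(act(x)·v)^ ≡ (r·a)⁻¹·(act(y)·v)^ (mod ẑ^{2g})` — ONE direction of ★ R60-43's iff, all the assembly consumes), and the scalar forms
  **`act_zsmul_mem_latticeOfGL_mul_of_forall_mem_ideleMulIdeal`** / **`forall_inv_mulVec_act_zsmul_sub_mem_of_forall_ideleMulEquiv`**: if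
  `N·∏𝔟̂ᵢ ⊆ Θ_v⁻¹(a·ẑ^{2g})` (`hlowN`), then `x ∈ ⊕ tᵢ𝔟ᵢ ⇒ act(N•x)·v ∈ Λ_{r·a}` and (18.3a) at `𝔟ᵢ` gives the congruence for
  `(act(N•x)·v, act(N•y)·v)` — census §2 «`M·v̂ ≡ M·N·x̂ (mod M·N·⊕𝔟̂ᵢ ⊆ q⁻¹Λ̂′)`», the clause up to the integer that ★ R60-44 removes.

## References
* [Deligne1971TravauxShimura] P. Deligne, *Travaux de Shimura*, Sém. Bourbaki 389 (1971), 3.9 p. 140, 4.18–4.20 pp. 150–152.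
* [Shimura1998] G. Shimura, *Abelian Varieties with Complex Multiplication and Modular Functions* (1998), §6.2 p. 42, §18.3 (18.3a)
  pp. 122–123, Thm. 18.6 p. 127, §18.8 (proof) p. 130.
* [Milne2005ShimuraVarieties] J. S. Milne, *Introduction to Shimura varieties* (2005), §4 pp. 48–49, Thm. 6.11, Thm. 11.2 p. 108,
  Def. 12.8 (60)–(63) pp. 114–116, Prop. 14.12 p. 125.
-/

set_option autoImplicit false

noncomputable section

open Module Function NumberField Matrix IsDedekindDomain
open scoped nonZeroDivisors

namespace Literature.AlgebraicGeometry.ModuliOfAbelianVarieties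

open Literature.NumberTheory.Automorphic (integralFiniteAdeles)
open Literature.NumberTheory.Adeles (latticeOfGL mem_latticeOfGL_iff)

/-! ### §1. Generic: lattice membership along an adelic congruence `a⁻¹·v̂ ≡ b⁻¹·ŵ (mod ẑⁿ)` -/

section Generic

variable {n : Type} [Fintype n] [DecidableEq n]

omit [Fintype n] [DecidableEq n] in
/-- The diagonal embedding `ℚⁿ → 𝔸_{ℚ,f}ⁿ` is compatible with subtraction. [cite: Milne2005ShimuraVarieties, §4 pp. 48–49] -/
theorem algebraMap_comp_sub (v w : n → ℚ) :
    (fun j => algebraMap ℚ finAdeleQ ((v - w) j)) =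
      (fun j => algebraMap ℚ finAdeleQ (v j)) - fun j => algebraMap ℚ finAdeleQ (w j) := by
  funext j
  rw [Pi.sub_apply, Pi.sub_apply, map_sub]

/-- **Along `a⁻¹·v̂ ≡ b⁻¹·ŵ (mod ẑⁿ)`, `v ∈ Λ_a ↔ w ∈ Λ_b`** (`Λ_a = ℚⁿ ∩ a·ẑⁿ`, ★ R60-19 `latticeOfGL`): the torsion clause of the
moduli reading ([Milne2005ShimuraVarieties] (63), «`η(v)` and `η′(w)` name the same torsion point») preserves «being the trivial torsion
point». [cite: Milne2005ShimuraVarieties, §4 pp. 48–49; §12 (63) p. 116] -/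
theorem mem_latticeOfGL_iff_of_inv_mulVec_sub_mem {a b : GL n finAdeleQ} {v w : n → ℚ}
    (h : ∀ j, ((((a⁻¹ : GL n finAdeleQ) : Matrix n n finAdeleQ) *ᵥ fun j => algebraMap ℚ finAdeleQ (v j)) -
      (((b⁻¹ : GL n finAdeleQ) : Matrix n n finAdeleQ) *ᵥ fun j => algebraMap ℚ finAdeleQ (w j))) j ∈
        integralFiniteAdeles ℚ) :
    v ∈ latticeOfGL a ↔ w ∈ latticeOfGL b := by
  rw [mem_latticeOfGL_iff, mem_latticeOfGL_iff]
  constructor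
  · intro hv j
    have hvj : (((a⁻¹ : GL n finAdeleQ) : Matrix n n finAdeleQ) *ᵥ fun j => algebraMap ℚ finAdeleQ (v j)) j ∈
        integralFiniteAdeles ℚ := hv j
    have h1 := sub_mem hvj (h j)
    rw [Pi.sub_apply, sub_sub_cancel] at h1
    exact h1
  · intro hw j
    have hwj : (((b⁻¹ : GL n finAdeleQ) : Matrix n n finAdeleQ) *ᵥ fun j => algebraMap ℚ finAdeleQ (w j)) j ∈
        integralFiniteAdeles ℚ := hw j
    have h1 := add_mem (h j) hwj
    rw [Pi.sub_apply, sub_add_cancel] at h1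
    exact h1

/-- **Two `w` for one `v` differ by `Λ_b`**: if `a⁻¹·v̂ ≡ b⁻¹·ŵ` and `a⁻¹·v̂ ≡ b⁻¹·ŵ′ (mod ẑⁿ)` then `w − w′ ∈ Λ_b` — the target of the
torsion clause is well defined modulo the lattice. [cite: Milne2005ShimuraVarieties, §4 pp. 48–49; §12 (63) p. 116] -/
theorem sub_mem_latticeOfGL_of_inv_mulVec_sub_mem₂ {a b : GL n finAdeleQ} {v w w' : n → ℚ}
    (h : ∀ j, ((((a⁻¹ : GL n finAdeleQ) : Matrix n n finAdeleQ) *ᵥ fun j => algebraMap ℚ finAdeleQ (v j)) -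
      (((b⁻¹ : GL n finAdeleQ) : Matrix n n finAdeleQ) *ᵥ fun j => algebraMap ℚ finAdeleQ (w j))) j ∈
        integralFiniteAdeles ℚ)
    (h' : ∀ j, ((((a⁻¹ : GL n finAdeleQ) : Matrix n n finAdeleQ) *ᵥ fun j => algebraMap ℚ finAdeleQ (v j)) -
      (((b⁻¹ : GL n finAdeleQ) : Matrix n n finAdeleQ) *ᵥ fun j => algebraMap ℚ finAdeleQ (w' j))) j ∈
        integralFiniteAdeles ℚ) :
    w - w' ∈ latticeOfGL b := by
  rw [mem_latticeOfGL_iff]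
  intro j
  have h1 := sub_mem (h' j) (h j)
  rw [Pi.sub_apply, Pi.sub_apply, sub_sub_sub_cancel_left, ← Pi.sub_apply, ← Matrix.mulVec_sub,
    ← algebraMap_comp_sub] at h1
  exact h1

/-- **Two `v` for one `w` differ by `Λ_a`**: if `a⁻¹·v̂ ≡ b⁻¹·ŵ` and `a⁻¹·v̂′ ≡ b⁻¹·ŵ (mod ẑⁿ)` then `v − v′ ∈ Λ_a`.
[cite: Milne2005ShimuraVarieties, §4 pp. 48–49; §12 (63) p. 116] -/
theorem sub_mem_latticeOfGL_of_inv_mulVec_sub_mem₁ {a b : GL n finAdeleQ} {v v' w : n → ℚ}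
    (h : ∀ j, ((((a⁻¹ : GL n finAdeleQ) : Matrix n n finAdeleQ) *ᵥ fun j => algebraMap ℚ finAdeleQ (v j)) -
      (((b⁻¹ : GL n finAdeleQ) : Matrix n n finAdeleQ) *ᵥ fun j => algebraMap ℚ finAdeleQ (w j))) j ∈
        integralFiniteAdeles ℚ)
    (h' : ∀ j, ((((a⁻¹ : GL n finAdeleQ) : Matrix n n finAdeleQ) *ᵥ fun j => algebraMap ℚ finAdeleQ (v' j)) -
      (((b⁻¹ : GL n finAdeleQ) : Matrix n n finAdeleQ) *ᵥ fun j => algebraMap ℚ finAdeleQ (w j))) j ∈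
        integralFiniteAdeles ℚ) :
    v - v' ∈ latticeOfGL a := by
  rw [mem_latticeOfGL_iff]
  intro j
  have h1 := sub_mem (h j) (h' j)
  rw [Pi.sub_apply, Pi.sub_apply, sub_sub_sub_cancel_right, ← Pi.sub_apply, ← Matrix.mulVec_sub,
    ← algebraMap_comp_sub] at h1
  exact h1

/-- **At one matrix the congruence is the lattice**: `a⁻¹·v̂ ≡ a⁻¹·ŵ (mod ẑⁿ) ↔ v − w ∈ Λ_a` ([Milne2005ShimuraVarieties] §4:
`ker (V → V(𝔸_f)/a·Λ̂) = Λ_a`). [cite: Milne2005ShimuraVarieties, §4 pp. 48–49] -/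
theorem inv_mulVec_sub_mem_self_iff {a : GL n finAdeleQ} {v w : n → ℚ} :
    (∀ j, ((((a⁻¹ : GL n finAdeleQ) : Matrix n n finAdeleQ) *ᵥ fun j => algebraMap ℚ finAdeleQ (v j)) -
      (((a⁻¹ : GL n finAdeleQ) : Matrix n n finAdeleQ) *ᵥ fun j => algebraMap ℚ finAdeleQ (w j))) j ∈
        integralFiniteAdeles ℚ) ↔
      v - w ∈ latticeOfGL a := by
  rw [mem_latticeOfGL_iff, ← Matrix.mulVec_sub, ← algebraMap_comp_sub]
  rfl

end Generic

namespace CMStructure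

open Literature.NumberTheory.NumberFields.IdeleAction
  (idealAdeles ideleMulIdeal ideleMulIdeal_def ideleMulIdeal_ne_zero mul_mem_idealAdeles_iff algebraMap_mem_idealAdeles_iff
    ideleMulEquiv ideleMulEquiv_mk_eq_mk_iff)

variable {g : ℕ} {δ : Fin g → ℕ} {ι : Type} [Fintype ι] [DecidableEq ι] {K : ι → Type} [∀ i, Field (K i)]
  [∀ i, NumberField (K i)] [∀ i, IsCMField (K i)] (c : CMStructure g δ ι K)

/-! ### §2. Transport identities through `r = R(t)` -/

/-- **`(r·a)⁻¹·R(t·u)·x = a⁻¹·R(u)·x`** for `(r : matrix) = R(t)`: `a⁻¹ = (r·a)⁻¹·R(t)` and `R` is multiplicative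
(★ `cmRepMatrix_mul_mulVec`). [cite: Deligne1971TravauxShimura, 3.9 p. 140 and 4.18 p. 150] -/
theorem inv_mul_mulVec_cmRepMatrix_mul_mulVec {a r : GL (Fin g ⊕ Fin g) finAdeleQ}
    {t : Π i, (FiniteAdeleRing (𝓞 (K i)) (K i))ˣ}
    (hr : ((r : GL (Fin g ⊕ Fin g) finAdeleQ) : Matrix (Fin g ⊕ Fin g) (Fin g ⊕ Fin g) finAdeleQ) =
      c.cmRepMatrix fun i => (t i : FiniteAdeleRing (𝓞 (K i)) (K i)))
    (u : Π i, FiniteAdeleRing (𝓞 (K i)) (K i)) (x : Fin g ⊕ Fin g → finAdeleQ) :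
    (((r * a)⁻¹ : GL (Fin g ⊕ Fin g) finAdeleQ) : Matrix (Fin g ⊕ Fin g) (Fin g ⊕ Fin g) finAdeleQ) *ᵥ
        (c.cmRepMatrix ((fun i => (t i : FiniteAdeleRing (𝓞 (K i)) (K i))) * u) *ᵥ x) =
      ((a⁻¹ : GL (Fin g ⊕ Fin g) finAdeleQ) : Matrix (Fin g ⊕ Fin g) (Fin g ⊕ Fin g) finAdeleQ) *ᵥ (c.cmRepMatrix u *ᵥ x) := by
  have hainv : ((a⁻¹ : GL (Fin g ⊕ Fin g) finAdeleQ) : Matrix (Fin g ⊕ Fin g) (Fin g ⊕ Fin g) finAdeleQ) =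
      (((r * a)⁻¹ : GL (Fin g ⊕ Fin g) finAdeleQ) : Matrix (Fin g ⊕ Fin g) (Fin g ⊕ Fin g) finAdeleQ) *
        c.cmRepMatrix fun i => (t i : FiniteAdeleRing (𝓞 (K i)) (K i)) := by
    rw [← hr, _root_.mul_inv_rev, Units.val_mul, Matrix.mul_assoc, Units.inv_mul, Matrix.mul_one]
  rw [hainv, ← Matrix.mulVec_mulVec, ← c.cmRepMatrix_mul_mulVec]

/-- **`(r·a)⁻¹·R(u)·x = a⁻¹·R(t⁻¹·u)·x`** for `(r : matrix) = R(t)` (the form used inside ★ R60-35 §2, exposed).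
[cite: Deligne1971TravauxShimura, 3.9 p. 140 and 4.18 p. 150] [cite: Shimura1998, §18.3 pp. 122–123] -/
theorem inv_mul_mulVec_cmRepMatrix_mulVec {a r : GL (Fin g ⊕ Fin g) finAdeleQ}
    {t : Π i, (FiniteAdeleRing (𝓞 (K i)) (K i))ˣ}
    (hr : ((r : GL (Fin g ⊕ Fin g) finAdeleQ) : Matrix (Fin g ⊕ Fin g) (Fin g ⊕ Fin g) finAdeleQ) =
      c.cmRepMatrix fun i => (t i : FiniteAdeleRing (𝓞 (K i)) (K i)))
    (u : Π i, FiniteAdeleRing (𝓞 (K i)) (K i)) (x : Fin g ⊕ Fin g → finAdeleQ) :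
    (((r * a)⁻¹ : GL (Fin g ⊕ Fin g) finAdeleQ) : Matrix (Fin g ⊕ Fin g) (Fin g ⊕ Fin g) finAdeleQ) *ᵥ (c.cmRepMatrix u *ᵥ x) =
      ((a⁻¹ : GL (Fin g ⊕ Fin g) finAdeleQ) : Matrix (Fin g ⊕ Fin g) (Fin g ⊕ Fin g) finAdeleQ) *ᵥ
        (c.cmRepMatrix ((fun i => (((t i)⁻¹ : (FiniteAdeleRing (𝓞 (K i)) (K i))ˣ) : FiniteAdeleRing (𝓞 (K i)) (K i))) * u) *ᵥ
          x) := by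
  have h1 : ((fun i => (t i : FiniteAdeleRing (𝓞 (K i)) (K i))) *
      fun i => (((t i)⁻¹ : (FiniteAdeleRing (𝓞 (K i)) (K i))ˣ) : FiniteAdeleRing (𝓞 (K i)) (K i))) = 1 := by
    funext i
    rw [Pi.mul_apply, Units.mul_inv, Pi.one_apply]
  have h2 := c.inv_mul_mulVec_cmRepMatrix_mul_mulVec (a := a) hr
    ((fun i => (((t i)⁻¹ : (FiniteAdeleRing (𝓞 (K i)) (K i))ˣ) : FiniteAdeleRing (𝓞 (K i)) (K i))) * u) x
  rw [← mul_assoc, h1, one_mul] at h2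
  exact h2

omit [Fintype ι] [DecidableEq ι] [∀ i, IsCMField (K i)] in
/-- `uᵢ ∈ (tᵢ𝔞ᵢ)^ ↔ tᵢ⁻¹uᵢ ∈ 𝔞̂ᵢ` (★ `IdeleAction.mul_mem_idealAdeles_iff`, Silverman's «`(x𝔞)_𝔭 = x_𝔭𝔞_𝔭`»). [folklore] -/
private theorem mem_idealAdeles_ideleMulIdeal_iff {i : ι} (ti : (FiniteAdeleRing (𝓞 (K i)) (K i))ˣ)
    {𝔞i : FractionalIdeal (𝓞 (K i))⁰ (K i)} (h𝔞i : 𝔞i ≠ 0) (ui : FiniteAdeleRing (𝓞 (K i)) (K i)) :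
    ui ∈ idealAdeles (ideleMulIdeal ti 𝔞i) ↔
      ((ti⁻¹ : (FiniteAdeleRing (𝓞 (K i)) (K i))ˣ) : FiniteAdeleRing (𝓞 (K i)) (K i)) * ui ∈ idealAdeles 𝔞i := by
  have hmem := mul_mem_idealAdeles_iff ti h𝔞i
    (a := ((ti⁻¹ : (FiniteAdeleRing (𝓞 (K i)) (K i))ˣ) : FiniteAdeleRing (𝓞 (K i)) (K i)) * ui)
  rw [← mul_assoc, Units.mul_inv, one_mul, ← ideleMulIdeal_def] at hmem
  exact hmem

/-! ### §3. Adelic transport of the two inclusions -/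

section Transport

variable {v : Fin g ⊕ Fin g → ℚ} {a r : GL (Fin g ⊕ Fin g) finAdeleQ} {t : Π i, (FiniteAdeleRing (𝓞 (K i)) (K i))ˣ}
  (hr : ((r : GL (Fin g ⊕ Fin g) finAdeleQ) : Matrix (Fin g ⊕ Fin g) (Fin g ⊕ Fin g) finAdeleQ) =
    c.cmRepMatrix fun i => (t i : FiniteAdeleRing (𝓞 (K i)) (K i)))
include hr

/-- **LOWER inclusion transported: `∏ᵢ 𝔞̂ᵢ ⊆ Θ_v⁻¹(a·ẑ^{2g}) ⇒ ∏ᵢ (tᵢ𝔞ᵢ)^ ⊆ Θ_v⁻¹((r·a)·ẑ^{2g})`** for `(r : matrix) = R(t)`: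
`(r·a)⁻¹·Θ_v(u) = a⁻¹·Θ_v(t⁻¹u)` and `u ∈ ∏(t𝔞)^ ↔ t⁻¹u ∈ ∏𝔞̂` — the adelic lattice of `[J, r·a]` CONTAINS `t·∏𝔞̂ᵢ` when that of `[J, a]`
contains `∏𝔞̂ᵢ` (Milne's «`σ[x, a] = [x, r_x(s)·a]`» moves the lower bound by the idèle). [cite: Milne2005ShimuraVarieties, Def. 12.8 (60)–(62) p. 114]
[cite: Shimura1998, §18.3 pp. 122–123] [cite: Deligne1971TravauxShimura, 4.18–4.20 pp. 150–152] -/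
theorem forall_inv_mul_mulVec_mem_of_forall_mem
    {𝔞 : Π i, FractionalIdeal (𝓞 (K i))⁰ (K i)} (h𝔞 : ∀ i, 𝔞 i ≠ 0)
    (hlow : ∀ u : Π i, FiniteAdeleRing (𝓞 (K i)) (K i), (∀ i, u i ∈ idealAdeles (𝔞 i)) →
      ∀ j, (((a⁻¹ : GL (Fin g ⊕ Fin g) finAdeleQ) : Matrix (Fin g ⊕ Fin g) (Fin g ⊕ Fin g) finAdeleQ) *ᵥ
          (c.cmRepMatrix u *ᵥ fun j => algebraMap ℚ finAdeleQ (v j))) j ∈ integralFiniteAdeles ℚ)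
    (u : Π i, FiniteAdeleRing (𝓞 (K i)) (K i)) (hu : ∀ i, u i ∈ idealAdeles (ideleMulIdeal (t i) (𝔞 i))) :
    ∀ j, ((((r * a)⁻¹ : GL (Fin g ⊕ Fin g) finAdeleQ) : Matrix (Fin g ⊕ Fin g) (Fin g ⊕ Fin g) finAdeleQ) *ᵥ
        (c.cmRepMatrix u *ᵥ fun j => algebraMap ℚ finAdeleQ (v j))) j ∈ integralFiniteAdeles ℚ := by
  rw [c.inv_mul_mulVec_cmRepMatrix_mulVec hr]
  refine hlow _ fun i => ?_
  rw [Pi.mul_apply]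
  exact (mem_idealAdeles_ideleMulIdeal_iff (t i) (h𝔞 i) (u i)).1 (hu i)

/-- **UPPER inclusion transported: `Θ_v⁻¹(a·ẑ^{2g}) ⊆ ∏ᵢ 𝔟̂ᵢ ⇒ Θ_v⁻¹((r·a)·ẑ^{2g}) ⊆ ∏ᵢ (tᵢ𝔟ᵢ)^`** for `(r : matrix) = R(t)` — the adelic
lattice of `[J, r·a]` is CONTAINED in `t·∏𝔟̂ᵢ` when that of `[J, a]` is contained in `∏𝔟̂ᵢ`.
[cite: Milne2005ShimuraVarieties, Def. 12.8 (60)–(62) p. 114] [cite: Shimura1998, §18.3 pp. 122–123] [cite: Deligne1971TravauxShimura, 4.18–4.20 pp. 150–152] -/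
theorem forall_mem_of_forall_inv_mul_mulVec_mem
    {𝔟 : Π i, FractionalIdeal (𝓞 (K i))⁰ (K i)} (h𝔟 : ∀ i, 𝔟 i ≠ 0)
    (hup : ∀ u : Π i, FiniteAdeleRing (𝓞 (K i)) (K i),
      (∀ j, (((a⁻¹ : GL (Fin g ⊕ Fin g) finAdeleQ) : Matrix (Fin g ⊕ Fin g) (Fin g ⊕ Fin g) finAdeleQ) *ᵥ
          (c.cmRepMatrix u *ᵥ fun j => algebraMap ℚ finAdeleQ (v j))) j ∈ integralFiniteAdeles ℚ) →
        ∀ i, u i ∈ idealAdeles (𝔟 i))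
    (u : Π i, FiniteAdeleRing (𝓞 (K i)) (K i))
    (hu : ∀ j, ((((r * a)⁻¹ : GL (Fin g ⊕ Fin g) finAdeleQ) : Matrix (Fin g ⊕ Fin g) (Fin g ⊕ Fin g) finAdeleQ) *ᵥ
        (c.cmRepMatrix u *ᵥ fun j => algebraMap ℚ finAdeleQ (v j))) j ∈ integralFiniteAdeles ℚ) :
    ∀ i, u i ∈ idealAdeles (ideleMulIdeal (t i) (𝔟 i)) := by
  rw [c.inv_mul_mulVec_cmRepMatrix_mulVec hr] at hu
  intro i
  have hi := hup _ hu i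
  rw [Pi.mul_apply] at hi
  exact (mem_idealAdeles_ideleMulIdeal_iff (t i) (h𝔟 i) (u i)).2 hi

/-! ### §4. Rational corollaries: `⊕ᵢ tᵢ𝔞ᵢ ⊆ q_v⁻¹(Λ_{r·a}) ⊆ ⊕ᵢ tᵢ𝔟ᵢ` -/

/-- **`x ∈ ⊕ᵢ tᵢ𝔞ᵢ ⇒ act(x)·v ∈ Λ_{r·a}`** (`(r : matrix) = R(t)`, lower inclusion `hlow` at `a`): the lattice of `[J, r·a]` read in `F`
CONTAINS `⊕ᵢ tᵢ𝔞ᵢ` — the integrality input of the torus map UP in route ξ′ (census STEP θ: «`M·eᵢ(Nᵢ𝔟ᵢ) ⊆ q⁻¹Λ′`» with `𝔞ᵢ = M𝔟ᵢ`,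
`tᵢ = Nᵢ`).  Shimura's `t𝔞 := K ∩ t𝔞̂` (★ `IdeleAction.ideleMulIdeal`). [cite: Shimura1998, §18.3 pp. 122–123; §18.8 (proof) p. 130]
[cite: Milne2005ShimuraVarieties, Def. 12.8 (60)–(62) p. 114] [cite: Deligne1971TravauxShimura, 4.18–4.20 pp. 150–152] -/
theorem act_mem_latticeOfGL_mul_of_forall_mem_ideleMulIdeal
    {𝔞 : Π i, FractionalIdeal (𝓞 (K i))⁰ (K i)} (h𝔞 : ∀ i, 𝔞 i ≠ 0)
    (hlow : ∀ u : Π i, FiniteAdeleRing (𝓞 (K i)) (K i), (∀ i, u i ∈ idealAdeles (𝔞 i)) →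
      ∀ j, (((a⁻¹ : GL (Fin g ⊕ Fin g) finAdeleQ) : Matrix (Fin g ⊕ Fin g) (Fin g ⊕ Fin g) finAdeleQ) *ᵥ
          (c.cmRepMatrix u *ᵥ fun j => algebraMap ℚ finAdeleQ (v j))) j ∈ integralFiniteAdeles ℚ)
    (x : Π i, K i) (hx : ∀ i, x i ∈ ideleMulIdeal (t i) (𝔞 i)) : c.act x v ∈ latticeOfGL (r * a) := by
  rw [mem_latticeOfGL_iff, ← c.cmRepMatrix_algebraMap_mulVec_algebraMap x v]
  exact c.forall_inv_mul_mulVec_mem_of_forall_mem hr h𝔞 hlow _ fun i =>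
    (algebraMap_mem_idealAdeles_iff (ideleMulIdeal_ne_zero (t i) (h𝔞 i))).2 (hx i)

/-- **`act(x)·v ∈ Λ_{r·a} ⇒ x ∈ ⊕ᵢ tᵢ𝔟ᵢ`** (`(r : matrix) = R(t)`, upper inclusion `hup` at `a`): the lattice of `[J, r·a]` read in
`F` is CONTAINED in `⊕ᵢ tᵢ𝔟ᵢ`. [cite: Shimura1998, §18.3 pp. 122–123; §18.8 (proof) p. 130]
[cite: Milne2005ShimuraVarieties, Def. 12.8 (60)–(62) p. 114] [cite: Deligne1971TravauxShimura, 4.18–4.20 pp. 150–152] -/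
theorem forall_mem_ideleMulIdeal_of_act_mem_latticeOfGL_mul
    {𝔟 : Π i, FractionalIdeal (𝓞 (K i))⁰ (K i)} (h𝔟 : ∀ i, 𝔟 i ≠ 0)
    (hup : ∀ u : Π i, FiniteAdeleRing (𝓞 (K i)) (K i),
      (∀ j, (((a⁻¹ : GL (Fin g ⊕ Fin g) finAdeleQ) : Matrix (Fin g ⊕ Fin g) (Fin g ⊕ Fin g) finAdeleQ) *ᵥ
          (c.cmRepMatrix u *ᵥ fun j => algebraMap ℚ finAdeleQ (v j))) j ∈ integralFiniteAdeles ℚ) →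
        ∀ i, u i ∈ idealAdeles (𝔟 i))
    (x : Π i, K i) (hx : c.act x v ∈ latticeOfGL (r * a)) : ∀ i, x i ∈ ideleMulIdeal (t i) (𝔟 i) := by
  rw [mem_latticeOfGL_iff, ← c.cmRepMatrix_algebraMap_mulVec_algebraMap x v] at hx
  exact fun i => (algebraMap_mem_idealAdeles_iff (ideleMulIdeal_ne_zero (t i) (h𝔟 i))).1
    (c.forall_mem_of_forall_inv_mul_mulVec_mem hr h𝔟 hup _ hx i)

/-! ### §5. The torsion clause up to the sandwich -/

/-- **Adelic form: `w − t·u ∈ ∏ᵢ (tᵢ𝔞ᵢ)^ ⇒ a⁻¹·Θ_v(u) ≡ (r·a)⁻¹·Θ_v(w) (mod ẑ^{2g})`** under the lower inclusion `hlow` at `𝔞` and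
`(r : matrix) = R(t)`: `a⁻¹·R(u)·v̂ − (r·a)⁻¹·R(w)·v̂ = (r·a)⁻¹·R(t·u − w)·v̂` (★ R60-43 `inv_mulVec_sub_mul_inv_mulVec`) and §3.
[cite: Shimura1998, §18.3 (18.3a) pp. 122–123] [cite: Milne2005ShimuraVarieties, §12 (63) p. 116] -/
theorem forall_inv_mulVec_sub_mem_of_forall_sub_mem
    {𝔞 : Π i, FractionalIdeal (𝓞 (K i))⁰ (K i)} (h𝔞 : ∀ i, 𝔞 i ≠ 0)
    (hlow : ∀ u : Π i, FiniteAdeleRing (𝓞 (K i)) (K i), (∀ i, u i ∈ idealAdeles (𝔞 i)) →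
      ∀ j, (((a⁻¹ : GL (Fin g ⊕ Fin g) finAdeleQ) : Matrix (Fin g ⊕ Fin g) (Fin g ⊕ Fin g) finAdeleQ) *ᵥ
          (c.cmRepMatrix u *ᵥ fun j => algebraMap ℚ finAdeleQ (v j))) j ∈ integralFiniteAdeles ℚ)
    (u w : Π i, FiniteAdeleRing (𝓞 (K i)) (K i))
    (huw : ∀ i, w i - (t i : FiniteAdeleRing (𝓞 (K i)) (K i)) * u i ∈ idealAdeles (ideleMulIdeal (t i) (𝔞 i))) :
    ∀ j, ((((a⁻¹ : GL (Fin g ⊕ Fin g) finAdeleQ) : Matrix (Fin g ⊕ Fin g) (Fin g ⊕ Fin g) finAdeleQ) *ᵥ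
            (c.cmRepMatrix u *ᵥ fun j => algebraMap ℚ finAdeleQ (v j))) -
          (((r * a)⁻¹ : GL (Fin g ⊕ Fin g) finAdeleQ) : Matrix (Fin g ⊕ Fin g) (Fin g ⊕ Fin g) finAdeleQ) *ᵥ
            (c.cmRepMatrix w *ᵥ fun j => algebraMap ℚ finAdeleQ (v j))) j ∈ integralFiniteAdeles ℚ := by
  rw [c.inv_mulVec_sub_mul_inv_mulVec hr]
  refine c.forall_inv_mul_mulVec_mem_of_forall_mem hr h𝔞 hlow _ fun i => ?_
  rw [← neg_mem_iff, Pi.sub_apply, Pi.mul_apply, neg_sub]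
  exact huw i

/-- **(18.3a) AT THE LOWER IDEALS IMPLIES THE TORSION CLAUSE OF THE MODULI READING.**  For `x, y ∈ F = ∏ᵢ Kᵢ`, under the lower inclusion
`hlow` («`∏ᵢ 𝔞̂ᵢ ⊆ Θ_v⁻¹(a·ẑ^{2g})`») and `(r : matrix) = R(t)`: if Shimura's `tᵢ · (xᵢ mod 𝔞ᵢ) = yᵢ mod tᵢ𝔞ᵢ` holds for every `i`
(★ `IdeleAction.ideleMulEquiv`, the clause of ★ `shimura1998_thm18_6` (2)), then `a⁻¹·(act(x)·v)^ ≡ (r·a)⁻¹·(act(y)·v)^ (mod ẑ^{2g})` —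
the relation «`η_a(act(x)·v)^σ` and `η_{r·a}(act(y)·v)` name the same torsion point» ([Milne2005ShimuraVarieties] (63); the cell's T1′
`AdelicCongr (a⁻¹) ((r·a)⁻¹)`).  One direction of ★ R60-43 `forall_inv_mulVec_act_sub_mem_iff_ideleMulEquiv`, valid WITHOUT the split
reading. [cite: Shimura1998, §18.3 (18.3a) pp. 122–123; §18.6 Thm. 18.6 (2) p. 127]
[cite: Milne2005ShimuraVarieties, §6 Thm. 6.11; §12 (63) p. 116; §14 Prop. 14.12 p. 125] [cite: Deligne1971TravauxShimura, 4.19–4.20 pp. 151–152] -/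
theorem forall_inv_mulVec_act_sub_mem_of_forall_ideleMulEquiv
    {𝔞 : Π i, FractionalIdeal (𝓞 (K i))⁰ (K i)} (h𝔞 : ∀ i, 𝔞 i ≠ 0)
    (hlow : ∀ u : Π i, FiniteAdeleRing (𝓞 (K i)) (K i), (∀ i, u i ∈ idealAdeles (𝔞 i)) →
      ∀ j, (((a⁻¹ : GL (Fin g ⊕ Fin g) finAdeleQ) : Matrix (Fin g ⊕ Fin g) (Fin g ⊕ Fin g) finAdeleQ) *ᵥ
          (c.cmRepMatrix u *ᵥ fun j => algebraMap ℚ finAdeleQ (v j))) j ∈ integralFiniteAdeles ℚ)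
    (x y : Π i, K i)
    (hxy : ∀ i, ideleMulEquiv (t i) (𝔞 i) (h𝔞 i) (Submodule.Quotient.mk (x i)) = Submodule.Quotient.mk (y i)) :
    ∀ j, ((((a⁻¹ : GL (Fin g ⊕ Fin g) finAdeleQ) : Matrix (Fin g ⊕ Fin g) (Fin g ⊕ Fin g) finAdeleQ) *ᵥ
            fun j => algebraMap ℚ finAdeleQ (c.act x v j)) -
          (((r * a)⁻¹ : GL (Fin g ⊕ Fin g) finAdeleQ) : Matrix (Fin g ⊕ Fin g) (Fin g ⊕ Fin g) finAdeleQ) *ᵥ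
            fun j => algebraMap ℚ finAdeleQ (c.act y v j)) j ∈ integralFiniteAdeles ℚ := by
  have hx : (fun j => algebraMap ℚ finAdeleQ (c.act x v j)) =
      c.cmRepMatrix (fun i => algebraMap (K i) (FiniteAdeleRing (𝓞 (K i)) (K i)) (x i)) *ᵥ
        fun j => algebraMap ℚ finAdeleQ (v j) :=
    (c.cmRepMatrix_algebraMap_mulVec_algebraMap x v).symm
  have hy : (fun j => algebraMap ℚ finAdeleQ (c.act y v j)) =
      c.cmRepMatrix (fun i => algebraMap (K i) (FiniteAdeleRing (𝓞 (K i)) (K i)) (y i)) *ᵥ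
        fun j => algebraMap ℚ finAdeleQ (v j) :=
    (c.cmRepMatrix_algebraMap_mulVec_algebraMap y v).symm
  rw [hx, hy]
  exact c.forall_inv_mulVec_sub_mem_of_forall_sub_mem hr h𝔞 hlow _ _ fun i =>
    (ideleMulEquiv_mk_eq_mk_iff (t i) (h𝔞 i)).1 (hxy i)

/-- **Scalar form of the lower integrality: `x ∈ ⊕ᵢ tᵢ𝔟ᵢ ⇒ act(N • x)·v ∈ Λ_{r·a}`** when `N·∏𝔟̂ᵢ ⊆ Θ_v⁻¹(a·ẑ^{2g})` (`hlowN`, the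
lower half of ★ R60-40a's sandwich `N·⊕𝔟ᵢ ⊆ q_v⁻¹(Λ_a) ⊆ ⊕𝔟ᵢ` read adelically) and `(r : matrix) = R(t)` — census STEP θ's
«`M·eᵢ(Nᵢ𝔟ᵢ) ⊆ q⁻¹Λ′`». [cite: Shimura1998, §6.2 p. 42 («commensurable»); §18.3 pp. 122–123; §18.8 (proof) p. 130]
[cite: Milne2005ShimuraVarieties, Def. 12.8 (60)–(62) p. 114] -/
theorem act_zsmul_mem_latticeOfGL_mul_of_forall_mem_ideleMulIdeal
    {𝔟 : Π i, FractionalIdeal (𝓞 (K i))⁰ (K i)} (h𝔟 : ∀ i, 𝔟 i ≠ 0) (N : ℤ)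
    (hlowN : ∀ u : Π i, FiniteAdeleRing (𝓞 (K i)) (K i), (∀ i, u i ∈ idealAdeles (𝔟 i)) →
      ∀ j, (((a⁻¹ : GL (Fin g ⊕ Fin g) finAdeleQ) : Matrix (Fin g ⊕ Fin g) (Fin g ⊕ Fin g) finAdeleQ) *ᵥ
          (c.cmRepMatrix (N • u) *ᵥ fun j => algebraMap ℚ finAdeleQ (v j))) j ∈ integralFiniteAdeles ℚ)
    (x : Π i, K i) (hx : ∀ i, x i ∈ ideleMulIdeal (t i) (𝔟 i)) : c.act (N • x) v ∈ latticeOfGL (r * a) := by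
  rw [mem_latticeOfGL_iff, ← c.cmRepMatrix_algebraMap_mulVec_algebraMap (N • x) v]
  have hN : (fun i => algebraMap (K i) (FiniteAdeleRing (𝓞 (K i)) (K i)) ((N • x) i)) =
      N • fun i => algebraMap (K i) (FiniteAdeleRing (𝓞 (K i)) (K i)) (x i) := by
    funext i
    rw [Pi.smul_apply, Pi.smul_apply, map_zsmul]
  rw [hN, c.inv_mul_mulVec_cmRepMatrix_mulVec hr, mul_smul_comm]
  refine hlowN _ fun i => ?_
  rw [Pi.mul_apply]
  exact (mem_idealAdeles_ideleMulIdeal_iff (t i) (h𝔟 i) _).1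
    ((algebraMap_mem_idealAdeles_iff (ideleMulIdeal_ne_zero (t i) (h𝔟 i))).2 (hx i))

/-- **Scalar form of the clause: (18.3a) at `𝔟ᵢ` gives the torsion clause for the `N`-MULTIPLES.**  If `N·∏𝔟̂ᵢ ⊆ Θ_v⁻¹(a·ẑ^{2g})` (`hlowN`)
and `(r : matrix) = R(t)`, then `tᵢ · (xᵢ mod 𝔟ᵢ) = yᵢ mod tᵢ𝔟ᵢ` for all `i` implies
`a⁻¹·(act(N • x)·v)^ ≡ (r·a)⁻¹·(act(N • y)·v)^ (mod ẑ^{2g})` — census route ξ′, last display line: «`M·v̂ ≡ M·N·x̂ (mod M·N·⊕𝔟̂ᵢ ⊆ q⁻¹Λ̂′)`»,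
the clause «up to the integer `M`» that the division step ★ R60-44 then removes. [cite: Shimura1998, §18.3 (18.3a) pp. 122–123; §18.6 Thm. 18.6 (2) p. 127]
[cite: Milne2005ShimuraVarieties, §12 (63) p. 116; §14 Prop. 14.12 p. 125] [cite: Deligne1971TravauxShimura, 4.19–4.20 pp. 151–152] -/
theorem forall_inv_mulVec_act_zsmul_sub_mem_of_forall_ideleMulEquiv
    {𝔟 : Π i, FractionalIdeal (𝓞 (K i))⁰ (K i)} (h𝔟 : ∀ i, 𝔟 i ≠ 0) (N : ℤ)
    (hlowN : ∀ u : Π i, FiniteAdeleRing (𝓞 (K i)) (K i), (∀ i, u i ∈ idealAdeles (𝔟 i)) →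
      ∀ j, (((a⁻¹ : GL (Fin g ⊕ Fin g) finAdeleQ) : Matrix (Fin g ⊕ Fin g) (Fin g ⊕ Fin g) finAdeleQ) *ᵥ
          (c.cmRepMatrix (N • u) *ᵥ fun j => algebraMap ℚ finAdeleQ (v j))) j ∈ integralFiniteAdeles ℚ)
    (x y : Π i, K i)
    (hxy : ∀ i, ideleMulEquiv (t i) (𝔟 i) (h𝔟 i) (Submodule.Quotient.mk (x i)) = Submodule.Quotient.mk (y i)) :
    ∀ j, ((((a⁻¹ : GL (Fin g ⊕ Fin g) finAdeleQ) : Matrix (Fin g ⊕ Fin g) (Fin g ⊕ Fin g) finAdeleQ) *ᵥ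
            fun j => algebraMap ℚ finAdeleQ (c.act (N • x) v j)) -
          (((r * a)⁻¹ : GL (Fin g ⊕ Fin g) finAdeleQ) : Matrix (Fin g ⊕ Fin g) (Fin g ⊕ Fin g) finAdeleQ) *ᵥ
            fun j => algebraMap ℚ finAdeleQ (c.act (N • y) v j)) j ∈ integralFiniteAdeles ℚ := by
  -- read both vectors through `Θ_v`, with the scalar pulled out
  have hvec : ∀ z : Π i, K i, (fun i => algebraMap (K i) (FiniteAdeleRing (𝓞 (K i)) (K i)) ((N • z) i)) =
      N • fun i => algebraMap (K i) (FiniteAdeleRing (𝓞 (K i)) (K i)) (z i) := fun z => by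
    funext i
    rw [Pi.smul_apply, Pi.smul_apply, map_zsmul]
  have hsm : ∀ z : Π i, K i, (fun j => algebraMap ℚ finAdeleQ (c.act (N • z) v j)) =
      c.cmRepMatrix (N • fun i => algebraMap (K i) (FiniteAdeleRing (𝓞 (K i)) (K i)) (z i)) *ᵥ
        fun j => algebraMap ℚ finAdeleQ (v j) := fun z => by
    rw [← hvec z]
    exact (c.cmRepMatrix_algebraMap_mulVec_algebraMap (N • z) v).symm
  rw [hsm x, hsm y, c.inv_mulVec_sub_mul_inv_mulVec hr, mul_smul_comm, ← smul_sub,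
    c.inv_mul_mulVec_cmRepMatrix_mulVec hr, mul_smul_comm]
  refine hlowN _ fun i => ?_
  rw [Pi.mul_apply]
  refine (mem_idealAdeles_ideleMulIdeal_iff (t i) (h𝔟 i) _).1 ?_
  rw [← neg_mem_iff, Pi.sub_apply, Pi.mul_apply, neg_sub]
  exact (ideleMulEquiv_mk_eq_mk_iff (t i) (h𝔟 i)).1 (hxy i)

end Transport

end CMStructure

end Literature.AlgebraicGeometry.ModuliOfAbelianVarieties

end
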